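import Summits.ValiantsHypothesis.ValiantsHypothesis.Theses.ShallowShadows
import Literature.Computability.AlgebraicComplexity.DetInVP
import Literature.Computability.AlgebraicComplexity.DeterminantIrreducible
import Literature.Computability.AlgebraicComplexity.PermanentIrreducible
import Literature.Computability.AlgebraicComplexity.StandardFamiliesProofs

/-!
# `ShadowFormulaTransfer` (crux stmt-ValiantsHypothesis-17124, route `ShallowShadows`):
# both hypotheses are load-bearing — modulo the route's own far side `RazWigdersonMatching`
# (Raz–Wigderson 1992), the crux is FALSE without the `0/1`-coefficient hypothesis (witness: the
# determinant family, coefficients `0, ±1`, in `VP`, shadow `PM_n`) and FALSE without the `VP`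
# hypothesis (witness: the permanent family, coefficients `0/1`, shadow `PM_n`)
# (negative-side support, refuter crux-attack seat; this file does NOT refute the crux)

`ShadowFormulaTransfer` says: `∃ δ > 0, ∃ C, ∀` p-families `f ∈ VP_ℂ` with all coefficients in
`{0,1}`, eventually in `n` the monotone formula size of the shadow
`B(f_n) : a ↦ [∃ m ∈ supp f_n, supp m ⊆ a]` is at most `2^((deg f_n)^(1-δ) (log(n+2))^C + C)`.

Recorded here, sorry-free and with the weakened statements spelled out inline (no proposition is
defined under `Summits/`):

* `shadow_eq_perfectMatchingFn` — any polynomial in the `n²` matrix variables whose support is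
  exactly the set of permutation monomials casts the bipartite perfect-matching shadow `PM_n`
  (`Literature.Barriers.PneNP.perfectMatchingFn`); in particular `B(det_n) = B(per_n) = PM_n`
  (`shadow_detPoly`, `shadow_perPoly`).
* `no_shallow_bound_of_razWigderson` — under `RazWigdersonMatching` (`2^{c n} ≤ L(PM_n)`
  eventually), NO family `F_n` with shadow `PM_n` and `deg F_n = n` satisfies the crux's bound, for
  any `δ > 0` and any `C` (the analytic window `x^{1-δ} (log(x+2))^C + C < c x` eventually; this is
  the contradiction step of the route's `closes`, isolated as a lemma).
* `shadowFormulaTransfer_false_with_unit_coefficients` — the crux with `coeff ∈ {0,1}` weakened to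
  `coeff ∈ {0,1,-1}` is false (modulo RW): `det_n ∈ VP` (`isVPFamily_detPoly_of_commRing`, Berkowitz)
  has coefficients `sign ρ ∈ {±1}` and shadow `PM_n`. So SIGN-COHERENCE of the coefficients, not
  merely their size, is what any proof must use; a fortiori
  `shadowFormulaTransfer_false_without_zeroOne` (the coefficient hypothesis dropped).
* `shadowFormulaTransfer_false_without_VP` — the crux with `IsVPFamily f` dropped is false
  (modulo RW): the permanent family has `0/1` coefficients and shadow `PM_n`.

Moral for provers/planners: the two hypotheses cut exactly between `det` (cheap, signed) and `per`
(`0/1`, presumably expensive), which have the SAME shadow; every proof of the crux must exploit the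
interaction of positivity with cheapness (e.g. Valiant's normal form `f = Q − R`, line `birth`).
-/

noncomputable section

set_option linter.dupNamespace false

namespace Summit.ValiantsHypothesis.ValiantsHypothesis.Theorems.ShadowFormulaTransfer.Negative

open Summit.ValiantsHypothesis.ValiantsHypothesis.Theses.ShallowShadows
open Literature.Computability.AlgebraicComplexity Literature.Computability.Complexity
open Literature.Barriers.PneNP (perfectMatchingFn)
open MvPolynomial Filter

/-- A polynomial in the matrix variables whose support is the set of permutation monomials casts
the perfect-matching shadow. [folklore] -/
theorem shadow_eq_perfectMatchingFn {m : ℕ} {R : Type*} [CommSemiring R]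
    {p : MvPolynomial (Fin m × Fin m) R}
    (hsupp : ∀ d, d ∈ p.support ↔ ∃ ρ : Equiv.Perm (Fin m), permMonomial ρ = d) :
    (fun a : Fin m × Fin m → Bool => decide (∃ d ∈ p.support, ∀ i ∈ d.support, a i = true)) =
      perfectMatchingFn m := by
  funext a
  unfold Literature.Barriers.PneNP.perfectMatchingFn
  refine decide_eq_decide.mpr ⟨?_, ?_⟩
  · rintro ⟨d, hd, ha⟩
    obtain ⟨ρ, rfl⟩ := (hsupp d).mp hd
    refine ⟨ρ.symm, fun i => ha _ ?_⟩
    rw [Finsupp.mem_support_iff, permMonomial_apply]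
    simp
  · rintro ⟨τ, hτ⟩
    refine ⟨permMonomial τ.symm, (hsupp _).mpr ⟨τ.symm, rfl⟩, fun q hq => ?_⟩
    rw [Finsupp.mem_support_iff, permMonomial_apply] at hq
    have h1 : τ.symm q.2 = q.1 := by
      by_contra h
      exact hq (if_neg h)
    have h2 : q = (q.1, τ q.1) := by
      ext
      · rfl
      · rw [← h1]; simp
    rw [h2]
    exact hτ q.1

/-- The support of the generic determinant over `ℂ` is the set of permutation monomials. [folklore] -/
theorem mem_support_detPoly_iff (m : ℕ) (d : Fin m × Fin m →₀ ℕ) :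
    d ∈ (detPoly (Fin m) ℂ).support ↔ ∃ ρ : Equiv.Perm (Fin m), permMonomial ρ = d := by
  rw [mem_support_iff]
  constructor
  · exact exists_permMonomial_eq_of_coeff_detPoly_ne_zero ℂ
  · rintro ⟨ρ, rfl⟩
    rw [coeff_permMonomial_detPoly]
    exact intCast_sign_ne_zero ℂ ρ

/-- The support of the generic permanent over `ℂ` is the set of permutation monomials. [folklore] -/
theorem mem_support_perPoly_iff (m : ℕ) (d : Fin m × Fin m →₀ ℕ) :
    d ∈ (perPoly (Fin m) ℂ).support ↔ ∃ ρ : Equiv.Perm (Fin m), permMonomial ρ = d := by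
  rw [mem_support_iff]
  constructor
  · exact exists_permMonomial_eq_of_coeff_perPoly_ne_zero ℂ
  · rintro ⟨ρ, rfl⟩
    rw [coeff_permMonomial_perPoly]
    exact one_ne_zero

/-- `B(det_n) = PM_n`. [folklore] -/
theorem shadow_detPoly (m : ℕ) :
    (fun a : Fin m × Fin m → Bool =>
        decide (∃ d ∈ (detPoly (Fin m) ℂ).support, ∀ i ∈ d.support, a i = true)) =
      perfectMatchingFn m :=
  shadow_eq_perfectMatchingFn (mem_support_detPoly_iff m)

/-- `B(per_n) = PM_n`. [folklore] -/
theorem shadow_perPoly (m : ℕ) :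
    (fun a : Fin m × Fin m → Bool =>
        decide (∃ d ∈ (perPoly (Fin m) ℂ).support, ∀ i ∈ d.support, a i = true)) =
      perfectMatchingFn m :=
  shadow_eq_perfectMatchingFn (mem_support_perPoly_iff m)

/-- The coefficients of `det_n` lie in `{0, 1, -1}`. [folklore] -/
theorem coeff_detPoly_unit (m : ℕ) (d : Fin m × Fin m →₀ ℕ) :
    (detPoly (Fin m) ℂ).coeff d = 0 ∨ (detPoly (Fin m) ℂ).coeff d = 1 ∨
      (detPoly (Fin m) ℂ).coeff d = -1 := by
  by_cases h : ∃ ρ : Equiv.Perm (Fin m), permMonomial ρ = d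
  · obtain ⟨ρ, rfl⟩ := h
    rw [coeff_permMonomial_detPoly]
    rcases Int.units_eq_one_or (Equiv.Perm.sign ρ) with h1 | h1
    · right; left; simp [h1]
    · right; right; simp [h1]
  · left
    by_contra hne
    exact h (exists_permMonomial_eq_of_coeff_detPoly_ne_zero ℂ hne)

/-- The coefficients of `per_n` lie in `{0, 1}`. [folklore] -/
theorem coeff_perPoly_zeroOne (m : ℕ) (d : Fin m × Fin m →₀ ℕ) :
    (perPoly (Fin m) ℂ).coeff d = 0 ∨ (perPoly (Fin m) ℂ).coeff d = 1 := by
  by_cases h : ∃ ρ : Equiv.Perm (Fin m), permMonomial ρ = d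
  · obtain ⟨ρ, rfl⟩ := h
    right
    exact coeff_permMonomial_perPoly ℂ ρ
  · left
    by_contra hne
    exact h (exists_permMonomial_eq_of_coeff_perPoly_ne_zero ℂ hne)

/-- `deg det_n = n` over `ℂ`. [folklore] -/
theorem totalDegree_detPoly_fin (m : ℕ) : (detPoly (Fin m) ℂ).totalDegree = m := by
  have h := @totalDegree_detPoly_holds (Fin m) _ _ ℂ
  unfold totalDegree_detPoly at h
  simpa using h

/-- `deg per_n = n` over `ℂ`. [folklore] -/
theorem totalDegree_perPoly_fin (m : ℕ) : (perPoly (Fin m) ℂ).totalDegree = m := by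
  have h := @totalDegree_perPoly_holds (Fin m) _ _ ℂ
  unfold totalDegree_perPoly at h
  simpa using h

/-- The analytic window: `x^{1-δ} (log (x+2))^C + C < c·x` eventually (`δ, c > 0`). This is the
asymptotic step of the route's `closes`, isolated. [folklore] -/
theorem eventually_window (δ : ℝ) (hδ : 0 < δ) (C : ℕ) (c : ℝ) (hc : 0 < c) :
    ∀ᶠ x : ℝ in atTop, x ^ (1 - δ) * Real.log (x + 2) ^ C + C < c * x := by
  have hlo := isLittleO_log_rpow_rpow_atTop (C : ℝ) hδ
  have hε : 0 < c / 2 ^ (C + 2) := by positivity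
  filter_upwards [hlo.def hε, eventually_ge_atTop (2 : ℝ), eventually_gt_atTop (4 * C / c + 1)]
    with x hx hx2 hxC
  have hx0 : 0 < x := by linarith
  have hlog2 : Real.log (x + 2) ≤ 2 * Real.log x := by
    have hsq : x + 2 ≤ x ^ 2 := by nlinarith
    calc Real.log (x + 2) ≤ Real.log (x ^ 2) := Real.log_le_log (by linarith) hsq
      _ = 2 * Real.log x := by rw [Real.log_pow]; norm_num
  have hlog0 : 0 ≤ Real.log (x + 2) := Real.log_nonneg (by linarith)
  have hlogx0 : 0 ≤ Real.log x := Real.log_nonneg (by linarith)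
  have hpowC : Real.log (x + 2) ^ C ≤ 2 ^ C * Real.log x ^ C := by
    calc Real.log (x + 2) ^ C ≤ (2 * Real.log x) ^ C := pow_le_pow_left₀ hlog0 hlog2 C
      _ = 2 ^ C * Real.log x ^ C := by rw [mul_pow]
  have hxδ0 : 0 < x ^ δ := Real.rpow_pos_of_pos hx0 δ
  have hlo' : Real.log x ^ C ≤ c / 2 ^ (C + 2) * x ^ δ := by
    have := hx
    rw [Real.norm_of_nonneg (by positivity), Real.norm_of_nonneg hxδ0.le] at this
    rwa [Real.rpow_natCast] at this
  have hx1δ0 : 0 < x ^ (1 - δ) := Real.rpow_pos_of_pos hx0 _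
  have hsplit : x ^ (1 - δ) * x ^ δ = x := by
    rw [← Real.rpow_add hx0]; norm_num
  have hconst : (2 : ℝ) ^ C * (c / 2 ^ (C + 2)) = c / 4 := by
    rw [pow_add]; field_simp; ring
  have hmain : x ^ (1 - δ) * Real.log (x + 2) ^ C ≤ c / 4 * x := by
    calc x ^ (1 - δ) * Real.log (x + 2) ^ C
        ≤ x ^ (1 - δ) * (2 ^ C * (c / 2 ^ (C + 2) * x ^ δ)) := by
          apply mul_le_mul_of_nonneg_left _ hx1δ0.le
          exact hpowC.trans (mul_le_mul_of_nonneg_left hlo' (by positivity))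
      _ = (2 ^ C * (c / 2 ^ (C + 2))) * (x ^ (1 - δ) * x ^ δ) := by ring
      _ = c / 4 * x := by rw [hconst, hsplit]
  have hCx : (C : ℝ) < c / 4 * x := by
    have : 4 * (C : ℝ) / c < x - 1 := by linarith
    have h4 : 4 * (C : ℝ) < (x - 1) * c := by
      rwa [div_lt_iff₀ hc] at this
    nlinarith
  nlinarith

/-- Under Raz–Wigderson, no family of matrix polynomials with shadow `PM_n` and degree `n`
obeys the crux's bound, whatever `δ > 0` and `C`. [folklore] -/
theorem no_shallow_bound_of_razWigderson (hRW : RazWigdersonMatching) {δ : ℝ} (hδ : 0 < δ)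
    {C : ℕ} (F : ∀ n, MvPolynomial (Fin n × Fin n) ℂ)
    (hshadow : ∀ n, (fun a : Fin n × Fin n → Bool =>
        decide (∃ d ∈ (F n).support, ∀ i ∈ d.support, a i = true)) = perfectMatchingFn n)
    (hdeg : ∀ n, (F n).totalDegree = n)
    (hB : ∃ n₀ : ℕ, ∀ n ≥ n₀, (formulaSizeOver monotoneBasis (fun a : Fin n × Fin n → Bool =>
        decide (∃ d ∈ (F n).support, ∀ i ∈ d.support, a i = true)) : ℝ) ≤
        2 ^ (((F n).totalDegree : ℝ) ^ (1 - δ) * (Real.log (n + 2)) ^ C + C)) : False := by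
  obtain ⟨n₀, hn₀⟩ := hB
  obtain ⟨c, hc, m₀, hm₀⟩ := hRW
  obtain ⟨N, hN⟩ := eventually_atTop.mp
    ((tendsto_natCast_atTop_atTop (R := ℝ)).eventually (eventually_window δ hδ C c hc))
  let n : ℕ := max (max n₀ m₀) N
  have hn₀' : n₀ ≤ n := (le_max_left _ _).trans (le_max_left _ _)
  have hm₀' : m₀ ≤ n := (le_max_right _ _).trans (le_max_left _ _)
  have hN' : N ≤ n := le_max_right _ _
  have hb := hn₀ n hn₀'
  have hr := hm₀ n hm₀'
  have hw := hN n hN'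
  rw [hshadow n, hdeg n] at hb
  have hchain := hr.trans hb
  rw [Real.rpow_le_rpow_left_iff (by norm_num : (1 : ℝ) < 2)] at hchain
  linarith

/-- **Sign-coherence is load-bearing.** Modulo `RazWigdersonMatching`, the crux with the
coefficient hypothesis weakened from `{0,1}` to `{0,1,-1}` is false: the determinant family is in
`VP` (Berkowitz), has coefficients `sign ρ`, and casts the shadow `PM_n` of depth `Ω(n) = Ω(deg)`.
[folklore; RazWigderson1992 for the hypothesis] -/
theorem shadowFormulaTransfer_false_with_unit_coefficients (hRW : RazWigdersonMatching) :
    ¬ (∃ δ : ℝ, 0 < δ ∧ ∃ C : ℕ, ∀ (σ : ℕ → Type) [∀ n, Fintype (σ n)] [∀ n, DecidableEq (σ n)]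
        (f : ∀ n, MvPolynomial (σ n) ℂ), IsVPFamily f →
        (∀ (n : ℕ) (m : σ n →₀ ℕ), (f n).coeff m = 0 ∨ (f n).coeff m = 1 ∨ (f n).coeff m = -1) →
        ∃ n₀ : ℕ, ∀ n ≥ n₀, (formulaSizeOver monotoneBasis (fun a : σ n → Bool =>
          decide (∃ m ∈ (f n).support, ∀ i ∈ m.support, a i = true)) : ℝ) ≤
          2 ^ (((f n).totalDegree : ℝ) ^ (1 - δ) * (Real.log (n + 2)) ^ C + C)) := by
  rintro ⟨δ, hδ, C, hC⟩
  exact no_shallow_bound_of_razWigderson hRW hδ (fun n => detPoly (Fin n) ℂ) shadow_detPoly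
    totalDegree_detPoly_fin
    (hC (fun n => Fin n × Fin n) (fun n => detPoly (Fin n) ℂ) (isVPFamily_detPoly_of_commRing ℂ)
      coeff_detPoly_unit)

/-- **The `0/1` hypothesis is load-bearing.** Modulo `RazWigdersonMatching`, the crux with the
coefficient hypothesis dropped is false (witness `det_n`). [folklore] -/
theorem shadowFormulaTransfer_false_without_zeroOne (hRW : RazWigdersonMatching) :
    ¬ (∃ δ : ℝ, 0 < δ ∧ ∃ C : ℕ, ∀ (σ : ℕ → Type) [∀ n, Fintype (σ n)] [∀ n, DecidableEq (σ n)]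
        (f : ∀ n, MvPolynomial (σ n) ℂ), IsVPFamily f →
        ∃ n₀ : ℕ, ∀ n ≥ n₀, (formulaSizeOver monotoneBasis (fun a : σ n → Bool =>
          decide (∃ m ∈ (f n).support, ∀ i ∈ m.support, a i = true)) : ℝ) ≤
          2 ^ (((f n).totalDegree : ℝ) ^ (1 - δ) * (Real.log (n + 2)) ^ C + C)) := by
  rintro ⟨δ, hδ, C, hC⟩
  exact shadowFormulaTransfer_false_with_unit_coefficients hRW
    ⟨δ, hδ, C, fun σ _ _ f hf _ => hC σ f hf⟩

/-- **The `VP` hypothesis is load-bearing.** Modulo `RazWigdersonMatching`, the crux with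
`IsVPFamily f` dropped is false: the permanent family has `0/1` coefficients and shadow `PM_n`.
[folklore] -/
theorem shadowFormulaTransfer_false_without_VP (hRW : RazWigdersonMatching) :
    ¬ (∃ δ : ℝ, 0 < δ ∧ ∃ C : ℕ, ∀ (σ : ℕ → Type) [∀ n, Fintype (σ n)] [∀ n, DecidableEq (σ n)]
        (f : ∀ n, MvPolynomial (σ n) ℂ),
        (∀ (n : ℕ) (m : σ n →₀ ℕ), (f n).coeff m = 0 ∨ (f n).coeff m = 1) →
        ∃ n₀ : ℕ, ∀ n ≥ n₀, (formulaSizeOver monotoneBasis (fun a : σ n → Bool =>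
          decide (∃ m ∈ (f n).support, ∀ i ∈ m.support, a i = true)) : ℝ) ≤
          2 ^ (((f n).totalDegree : ℝ) ^ (1 - δ) * (Real.log (n + 2)) ^ C + C)) := by
  rintro ⟨δ, hδ, C, hC⟩
  exact no_shallow_bound_of_razWigderson hRW hδ (fun n => perPoly (Fin n) ℂ) shadow_perPoly
    totalDegree_perPoly_fin
    (hC (fun n => Fin n × Fin n) (fun n => perPoly (Fin n) ℂ) coeff_perPoly_zeroOne)

end Summit.ValiantsHypothesis.ValiantsHypothesis.Theorems.ShadowFormulaTransfer.Negative

end
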